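import Mathlib
import Summits.ValiantsHypothesis.ValiantsHypothesis.Theorems.BinomialElusiveBinomialCandidateAffinePeeling
import Summits.ValiantsHypothesis.ValiantsHypothesis.Theorems.BinomialElusiveBinomialCandidateMonomialSubstitution

/-!
# Crux `BinomialElusive.BinomialCandidate` (stmt-ValiantsHypothesis-7392), line `registered` —
# stub `stub_lowDegreeVanishing`: low-degree coefficients of a fewnomial congruence vanish

The combinatorial half of "no immersive integral solution" (skeleton v2 of the line).  Data:
exponents `a b : Fin m → ℕ`, `N > 0`, the binomials `T_i := t^{N a_i} + t^{N b_i} ∈ ℂ((t))`,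
(P1) no nonzero integer relation `Σ_i (u_i a_i + v_i b_i) = 0` of length `Σ_i (|u_i| + |v_i|) ≤ 4`,
(P2) a modulus `M'` with `a_i ≡ b_i ≡ 1 (mod M')` and `2 e < M' e'` for all exponents `e, e'`.
Claim (`stub_lowDegreeVanishing`): if a polynomial `ψ` in the variables `X_i`, `i ≠ i₀` (no monomial
of `ψ` involves `X_{i₀}`), without constant term, satisfies `ψ(T) ≡ T_{i₀} (mod t^G)` with `G`
beyond twice every `N a_i`, `N b_i`, then every coefficient of `ψ` of degree `≤ 2` vanishes.

Proof.  Expand `ψ(T) = Σ_γ c_γ Π_i T_i^{γ_i}` by the binomial theorem: the coefficient of `t^g` is the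
sum of `c_γ Π_i C(γ_i, s_i)` over the pairs `(γ, s)`, `s ≤ γ`, with
`N Σ_i (s_i a_i + (γ_i - s_i) b_i) = g` (`coeff_aeval_binomial`).  Fix `d ≠ 0` of degree `≤ 2` and
look at the exponent `e⋆ := N Σ_i d_i a_i < G`.  A pair `(γ, s)` with exponent `e⋆` has
`|γ| · e_min ≤ Σ_i d_i a_i < M' e_min`, so `|γ| < M'`; reducing modulo `M'` gives `|γ| ≡ |d|`, hence
`|γ| = |d| ≤ 2`; then `(s - d, γ - s)` is a relation of length `≤ |d| + |γ| ≤ 4`, so by (P1) it is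
zero: `(γ, s) = (d, d)` (`split_unique`).  Hence the coefficient of `ψ(T)` at `e⋆` is `c_d`, while the
coefficient of `T_{i₀}` at `e⋆` vanishes (an equality `Σ_i d_i a_i = a_{i₀}` or `= b_{i₀}` would be a
relation of length `≤ 3`, as `d_{i₀} = 0`).  So `c_d = 0`; the degree-`0` coefficient is the constant
term.  Mathlib only (plus the wave-1 helpers `AffinePeeling.coeff_binomial`,
`AffinePeeling.algebraMap_laurentSeries_apply`, `MonomialSubstitution.prod_single`).
-/

-- layout Summits/ValiantsHypothesis/ValiantsHypothesis forces the duplicated namespace component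
set_option linter.dupNamespace false

namespace Summit.ValiantsHypothesis.ValiantsHypothesis.Theorems.BinomialCandidateStubs

open scoped BigOperators
open Finset

namespace LowDegreeVanishing

/-! ## Expansion of `ψ(T)` for binomial substitutions -/

/-- Binomial theorem for a sum of two Laurent monomials:
`(t^x + t^y)^n = Σ_k C(n,k) t^{k x + (n-k) y}`. -/
theorem binomial_pow (x y : ℤ) (n : ℕ) :
    ((HahnSeries.single x (1 : ℂ) + HahnSeries.single y (1 : ℂ) : LaurentSeries ℂ)) ^ n =
      ∑ k ∈ range (n + 1),
        HahnSeries.single (k • x + (n - k) • y) (((n.choose k : ℕ)) : ℂ) := by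
  rw [add_pow]
  refine sum_congr rfl fun k _ => ?_
  rw [HahnSeries.single_pow, HahnSeries.single_pow, one_pow, one_pow, HahnSeries.single_mul_single,
    mul_one, ← HahnSeries.single_zero_natCast (Γ := ℤ) (R := ℂ) (n.choose k),
    HahnSeries.single_mul_single, add_zero, one_mul]

/-- Expansion of a product of binomial powers `Π_i (t^{x_i} + t^{y_i})^{γ_i}` over the splittings
`s ≤ γ` (`s_i` factors `t^{x_i}`, `γ_i - s_i` factors `t^{y_i}`). -/
theorem prod_binomial_pow {m : ℕ} (x y : Fin m → ℤ) (γ : Fin m → ℕ) :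
    ∏ i, ((HahnSeries.single (x i) (1 : ℂ) + HahnSeries.single (y i) (1 : ℂ) : LaurentSeries ℂ)) ^ γ i =
      ∑ s ∈ Fintype.piFinset (fun i => range (γ i + 1)),
        HahnSeries.single (∑ i, (s i • x i + (γ i - s i) • y i))
          (∏ i, (((γ i).choose (s i) : ℕ) : ℂ)) := by
  simp_rw [binomial_pow]
  rw [prod_univ_sum]
  refine sum_congr rfl fun s _ => ?_
  exact MonomialSubstitution.prod_single _ _ _

/-- The coefficients of `ψ(T)` for a binomial substitution `T_i = t^{x_i} + t^{y_i}`: the coefficient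
of `t^g` is the sum of `coeff γ ψ · Π_i C(γ_i, s_i)` over the pairs `(γ, s)`, `γ` a monomial of `ψ`,
`s ≤ γ`, with `Σ_i (s_i x_i + (γ_i - s_i) y_i) = g`. -/
theorem coeff_aeval_binomial {m : ℕ} (x y : Fin m → ℤ) (ψ : MvPolynomial (Fin m) ℂ) (g : ℤ) :
    (MvPolynomial.aeval (fun i : Fin m =>
        (HahnSeries.single (x i) (1 : ℂ) + HahnSeries.single (y i) (1 : ℂ) : LaurentSeries ℂ)) ψ).coeff g =
      ∑ γ ∈ ψ.support, ∑ s ∈ Fintype.piFinset (fun i => range (γ i + 1)),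
        if g = ∑ i, (s i • x i + (γ i - s i) • y i) then
          MvPolynomial.coeff γ ψ * ∏ i, (((γ i).choose (s i) : ℕ) : ℂ) else 0 := by
  classical
  conv_lhs => rw [MvPolynomial.as_sum ψ]
  simp only [map_sum, HahnSeries.coeff_sum]
  refine sum_congr rfl fun γ _ => ?_
  rw [MvPolynomial.aeval_monomial, Finsupp.prod_fintype _ _ (fun j => pow_zero _),
    AffinePeeling.algebraMap_laurentSeries_apply, prod_binomial_pow, mul_sum, HahnSeries.coeff_sum]
  refine sum_congr rfl fun s _ => ?_
  rw [HahnSeries.single_mul_single, zero_add, HahnSeries.coeff_single]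
  by_cases h : g = ∑ i, (s i • x i + (γ i - s i) • y i) <;> simp [h]

/-- Bookkeeping of casts: the exponent of the splitting `(γ, s)` for `x_i = N a_i`, `y_i = N b_i`. -/
theorem exponent_cast {m : ℕ} (N : ℕ) (a b γ s : Fin m → ℕ) :
    ∑ i, (s i • ((N * a i : ℕ) : ℤ) + (γ i - s i) • ((N * b i : ℕ) : ℤ)) =
      ((N * ∑ i, (s i * a i + (γ i - s i) * b i) : ℕ) : ℤ) := by
  simp only [nsmul_eq_mul]
  push_cast
  rw [mul_sum]
  refine sum_congr rfl fun i _ => ?_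
  ring

/-! ## Arithmetic of the exponent data: (P1) and (P2) -/

/-- From (P2): a common lower bound `e` of all the exponents with `2 a_j < M' e` and `2 b_j < M' e`. -/
theorem exists_lower {m : ℕ} (a b : Fin m → ℕ) (M' : ℕ)
    (hlt : ∀ i j, 2 * a i < M' * a j ∧ 2 * a i < M' * b j ∧ 2 * b i < M' * a j ∧ 2 * b i < M' * b j)
    (i₀ : Fin m) :
    ∃ e : ℕ, (∀ i, e ≤ a i ∧ e ≤ b i) ∧ ∀ j, 2 * a j < M' * e ∧ 2 * b j < M' * e := by
  obtain ⟨i₁, -, hi₁⟩ := exists_min_image univ (fun i => min (a i) (b i)) ⟨i₀, mem_univ _⟩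
  refine ⟨min (a i₁) (b i₁), fun i => ⟨(hi₁ i (mem_univ _)).trans (min_le_left _ _),
    (hi₁ i (mem_univ _)).trans (min_le_right _ _)⟩, fun j => ?_⟩
  rcases min_choice (a i₁) (b i₁) with h | h <;> rw [h]
  · exact ⟨(hlt j i₁).1, (hlt j i₁).2.2.1⟩
  · exact ⟨(hlt j i₁).2.1, (hlt j i₁).2.2.2⟩

/-- **Uniqueness of the low splitting.**  Under (P1) and (P2), if `d ≠ 0` has degree `|d| ≤ 2` and a
splitting `(γ, s)` (`s ≤ γ`) has the exponent of the all-lower splitting `(d, d)`, i.e.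
`Σ_i (s_i a_i + (γ_i - s_i) b_i) = Σ_i d_i a_i`, then `(γ, s) = (d, d)`. -/
theorem split_unique {m : ℕ} (a b : Fin m → ℕ) (M' : ℕ)
    (hP1 : ∀ u v : Fin m → ℤ, ∑ i, (|u i| + |v i|) ≤ 4 →
      ∑ i, (u i * (a i : ℤ) + v i * (b i : ℤ)) = 0 → (u, v) = 0)
    (hmod : ∀ i, a i % M' = 1 ∧ b i % M' = 1)
    (hlt : ∀ i j, 2 * a i < M' * a j ∧ 2 * a i < M' * b j ∧ 2 * b i < M' * a j ∧ 2 * b i < M' * b j)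
    (d : Fin m → ℕ) (hd2 : ∑ i, d i ≤ 2) (hd0 : d ≠ 0)
    (γ s : Fin m → ℕ) (hs : ∀ i, s i ≤ γ i)
    (he : ∑ i, (s i * a i + (γ i - s i) * b i) = ∑ i, d i * a i) :
    s = d ∧ γ = d := by
  -- an index in the support of `d`
  obtain ⟨i₀, hi₀⟩ : ∃ i, d i ≠ 0 := by
    by_contra h
    push Not at h
    exact hd0 (funext h)
  have hM' : 2 < M' := lt_of_mul_lt_mul_right (hlt i₀ i₀).1 (Nat.zero_le _)
  obtain ⟨e, hle, helt⟩ := exists_lower a b M' hlt i₀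
  -- (a) `|γ| < M'`
  have h1 : (∑ i, γ i) * e ≤ ∑ i, d i * a i := by
    rw [← he, sum_mul]
    refine sum_le_sum fun i _ => ?_
    calc γ i * e = s i * e + (γ i - s i) * e := by rw [← add_mul, Nat.add_sub_of_le (hs i)]
      _ ≤ s i * a i + (γ i - s i) * b i :=
        add_le_add (Nat.mul_le_mul_left _ (hle i).1) (Nat.mul_le_mul_left _ (hle i).2)
  have h2 : 2 * ∑ i, d i * a i < 2 * (M' * e) := by
    calc 2 * ∑ i, d i * a i = ∑ i, d i * (2 * a i) := by
          rw [mul_sum]; exact sum_congr rfl fun i _ => by ring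
      _ < ∑ i, d i * (M' * e) :=
          sum_lt_sum (fun i _ => Nat.mul_le_mul_left _ (helt i).1.le)
            ⟨i₀, mem_univ _, mul_lt_mul_of_pos_left (helt i₀).1 (Nat.pos_of_ne_zero hi₀)⟩
      _ = (∑ i, d i) * (M' * e) := by rw [sum_mul]
      _ ≤ 2 * (M' * e) := Nat.mul_le_mul_right _ hd2
  have hγM : ∑ i, γ i < M' := by
    have h3 : (∑ i, γ i) * e < M' * e := by omega
    exact lt_of_mul_lt_mul_right h3 (Nat.zero_le _)
  -- (b) `|γ| = |d|` by reduction modulo `M'`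
  have hγd : ∑ i, γ i = ∑ i, d i := by
    have ha : ∀ i, ((a i : ℕ) : ZMod M') = 1 := fun i => by
      rw [← ZMod.natCast_mod (a i) M', (hmod i).1, Nat.cast_one]
    have hb : ∀ i, ((b i : ℕ) : ZMod M') = 1 := fun i => by
      rw [← ZMod.natCast_mod (b i) M', (hmod i).2, Nat.cast_one]
    have hcast : ((∑ i, (s i * a i + (γ i - s i) * b i) : ℕ) : ZMod M') =
        ((∑ i, d i * a i : ℕ) : ZMod M') := by rw [he]
    push_cast at hcast
    simp only [ha, hb, mul_one] at hcast
    have hγ' : ((∑ i, γ i : ℕ) : ZMod M') = ((∑ i, d i : ℕ) : ZMod M') := by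
      push_cast
      rw [← hcast]
      refine sum_congr rfl fun i _ => ?_
      rw [← Nat.cast_add, Nat.add_sub_of_le (hs i)]
    have := (ZMod.natCast_eq_natCast_iff' _ _ _).1 hγ'
    rwa [Nat.mod_eq_of_lt hγM, Nat.mod_eq_of_lt (hd2.trans_lt hM')] at this
  -- (c) `(s - d, γ - s)` is a relation of length `≤ |d| + |γ| ≤ 4`
  have key := hP1 (fun i => (s i : ℤ) - d i) (fun i => ((γ i - s i : ℕ) : ℤ)) ?_ ?_
  · simp only [Prod.mk_eq_zero, funext_iff, Pi.zero_apply, sub_eq_zero, Nat.cast_inj,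
      Nat.cast_eq_zero] at key
    obtain ⟨hu, hv⟩ := key
    refine ⟨funext hu, funext fun i => ?_⟩
    have h4 := hv i
    have h5 := hu i
    have h6 := hs i
    omega
  · -- length
    have hterm : ∀ i, |(s i : ℤ) - d i| + |((γ i - s i : ℕ) : ℤ)| ≤ ((d i + γ i : ℕ) : ℤ) := by
      intro i
      have h4 : |(s i : ℤ) - d i| ≤ (s i : ℤ) + d i := abs_le.2 ⟨by omega, by omega⟩
      have h5 : |((γ i - s i : ℕ) : ℤ)| = ((γ i - s i : ℕ) : ℤ) := abs_of_nonneg (by positivity)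
      have h6 := hs i
      rw [h5]
      push_cast
      omega
    calc ∑ i, (|(s i : ℤ) - d i| + |((γ i - s i : ℕ) : ℤ)|)
        ≤ ∑ i, ((d i + γ i : ℕ) : ℤ) := sum_le_sum fun i _ => hterm i
      _ = ((∑ i, d i + ∑ i, γ i : ℕ) : ℤ) := by push_cast; rw [sum_add_distrib]
      _ ≤ 4 := by rw [hγd]; norm_cast; omega
  · -- relation
    have hz : ((∑ i, (s i * a i + (γ i - s i) * b i) : ℕ) : ℤ) = ((∑ i, d i * a i : ℕ) : ℤ) := by
      rw [he]
    push_cast at hz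
    calc ∑ i, (((s i : ℤ) - d i) * (a i : ℤ) + ((γ i - s i : ℕ) : ℤ) * (b i : ℤ))
        = ∑ i, ((s i : ℤ) * a i + ((γ i - s i : ℕ) : ℤ) * b i) - ∑ i, (d i : ℤ) * a i := by
          rw [← sum_sub_distrib]
          exact sum_congr rfl fun i _ => by ring
      _ = 0 := by rw [hz, sub_self]

/-- From (P1): for `|d| ≤ 2` with `d_{i₀} = 0`, `Σ_i d_i a_i` is neither `a_{i₀}` nor `b_{i₀}`
(either equality is a nonzero relation of length `≤ 3`). -/
theorem sum_ne_of_noShortRelation {m : ℕ} (a b : Fin m → ℕ)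
    (hP1 : ∀ u v : Fin m → ℤ, ∑ i, (|u i| + |v i|) ≤ 4 →
      ∑ i, (u i * (a i : ℤ) + v i * (b i : ℤ)) = 0 → (u, v) = 0)
    (d : Fin m → ℕ) (hd2 : ∑ i, d i ≤ 2) (i₀ : Fin m) (hdi₀ : d i₀ = 0) :
    ∑ i, d i * a i ≠ a i₀ ∧ ∑ i, d i * a i ≠ b i₀ := by
  have hsum : (∑ i, (d i : ℤ)) ≤ 2 := by exact_mod_cast hd2
  constructor
  · intro h
    have key := hP1 (fun i => (d i : ℤ) - if i = i₀ then 1 else 0) 0 ?_ ?_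
    · have := congrFun (Prod.mk_eq_zero.mp key).1 i₀
      simp [hdi₀] at this
    · simp only [Pi.zero_apply, abs_zero, add_zero]
      calc ∑ i, |(d i : ℤ) - if i = i₀ then 1 else 0|
          ≤ ∑ i, ((d i : ℤ) + if i = i₀ then 1 else 0) := by
            refine sum_le_sum fun i _ => ?_
            split_ifs
            · exact abs_le.2 ⟨by omega, by omega⟩
            · simp
        _ = ∑ i, (d i : ℤ) + 1 := by rw [sum_add_distrib, sum_ite_eq']; simp
        _ ≤ 4 := by omega
    · have hz : ((∑ i, d i * a i : ℕ) : ℤ) = (a i₀ : ℤ) := by exact_mod_cast h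
      push_cast at hz
      simp only [Pi.zero_apply, zero_mul, add_zero, sub_mul, sum_sub_distrib, ite_mul, one_mul,
        sum_ite_eq', mem_univ, if_true]
      rw [hz, sub_self]
  · intro h
    have key := hP1 (fun i => (d i : ℤ)) (fun i => if i = i₀ then -1 else 0) ?_ ?_
    · have := congrFun (Prod.mk_eq_zero.mp key).2 i₀
      simp at this
    · calc ∑ i, (|(d i : ℤ)| + |(if i = i₀ then (-1 : ℤ) else 0)|)
          = ∑ i, ((d i : ℤ) + if i = i₀ then 1 else 0) := by
            refine sum_congr rfl fun i _ => ?_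
            rw [Nat.abs_cast]
            split_ifs <;> simp
        _ = ∑ i, (d i : ℤ) + 1 := by rw [sum_add_distrib, sum_ite_eq']; simp
        _ ≤ 4 := by omega
    · have hz : ((∑ i, d i * a i : ℕ) : ℤ) = (b i₀ : ℤ) := by exact_mod_cast h
      push_cast at hz
      simp only [ite_mul, neg_one_mul, zero_mul, sum_add_distrib, sum_ite_eq', mem_univ, if_true]
      rw [hz, add_neg_cancel]

/-- The special exponent `e⋆ = N Σ_i d_i a_i` (`|d| ≤ 2`) lies below the precision `G`. -/
theorem special_lt {m : ℕ} {a b : Fin m → ℕ} {N : ℕ} {G : ℤ}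
    (hG : ∀ i, 2 * ((N * a i : ℕ) : ℤ) < G ∧ 2 * ((N * b i : ℕ) : ℤ) < G)
    {d : Fin m → ℕ} (hd2 : ∑ i, d i ≤ 2) (i₀ : Fin m) :
    ((N * ∑ i, d i * a i : ℕ) : ℤ) < G := by
  obtain ⟨j, -, hj⟩ := exists_max_image univ a ⟨i₀, mem_univ _⟩
  have h1 : ∑ i, d i * a i ≤ 2 * a j := by
    calc ∑ i, d i * a i ≤ ∑ i, d i * a j := sum_le_sum fun i _ => Nat.mul_le_mul_left _ (hj i (mem_univ _))
      _ = (∑ i, d i) * a j := by rw [sum_mul]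
      _ ≤ 2 * a j := Nat.mul_le_mul_right _ hd2
  have h2 : N * ∑ i, d i * a i ≤ 2 * (N * a j) := by
    calc N * ∑ i, d i * a i ≤ N * (2 * a j) := Nat.mul_le_mul_left _ h1
      _ = 2 * (N * a j) := by ring
  calc ((N * ∑ i, d i * a i : ℕ) : ℤ) ≤ ((2 * (N * a j) : ℕ) : ℤ) := by exact_mod_cast h2
    _ = 2 * ((N * a j : ℕ) : ℤ) := by push_cast; ring
    _ < G := (hG j).1

/-- **The coefficient of `ψ(T)` at the special exponent** `e⋆ = N Σ_i d_i a_i` of a monomial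
`d ≠ 0` of degree `≤ 2` is `coeff d ψ`: by `split_unique` the only splitting with exponent `e⋆` is
the all-lower splitting `(d, d)` of `d` itself. -/
theorem coeff_aeval_special {m : ℕ} (a b : Fin m → ℕ) (N M' : ℕ) (hN : 0 < N)
    (hP1 : ∀ u v : Fin m → ℤ, ∑ i, (|u i| + |v i|) ≤ 4 →
      ∑ i, (u i * (a i : ℤ) + v i * (b i : ℤ)) = 0 → (u, v) = 0)
    (hmod : ∀ i, a i % M' = 1 ∧ b i % M' = 1)
    (hlt : ∀ i j, 2 * a i < M' * a j ∧ 2 * a i < M' * b j ∧ 2 * b i < M' * a j ∧ 2 * b i < M' * b j)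
    (ψ : MvPolynomial (Fin m) ℂ) (d : Fin m →₀ ℕ) (hd2 : ∑ i, d i ≤ 2) (hd0 : d ≠ 0) :
    (MvPolynomial.aeval (fun i : Fin m => (HahnSeries.single ((N * a i : ℕ) : ℤ) (1 : ℂ) +
        HahnSeries.single ((N * b i : ℕ) : ℤ) (1 : ℂ) : LaurentSeries ℂ)) ψ).coeff
        ((N * ∑ i, d i * a i : ℕ) : ℤ) = MvPolynomial.coeff d ψ := by
  classical
  rw [coeff_aeval_binomial]
  have hcond : ∀ (γ : Fin m →₀ ℕ) (s : Fin m → ℕ),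
      s ∈ Fintype.piFinset (fun i => range (γ i + 1)) →
      ((N * ∑ i, d i * a i : ℕ) : ℤ) =
        ∑ i, (s i • ((N * a i : ℕ) : ℤ) + (γ i - s i) • ((N * b i : ℕ) : ℤ)) →
      s = ⇑d ∧ ⇑γ = ⇑d := by
    intro γ s hs hex
    have hs' : ∀ i, s i ≤ γ i := fun i =>
      Nat.lt_succ_iff.mp (mem_range.mp (Fintype.mem_piFinset.mp hs i))
    rw [exponent_cast, Nat.cast_inj] at hex
    exact split_unique a b M' hP1 hmod hlt (⇑d) hd2 (fun h => hd0 (Finsupp.coe_eq_zero.mp h)) (⇑γ) s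
      hs' (Nat.eq_of_mul_eq_mul_left hN hex).symm
  rw [sum_eq_single d ?_ ?_]
  · rw [sum_eq_single_of_mem (⇑d : Fin m → ℕ) ?_ ?_]
    · have hc : ((N * ∑ i, d i * a i : ℕ) : ℤ) =
          ∑ i, (d i • ((N * a i : ℕ) : ℤ) + (d i - d i) • ((N * b i : ℕ) : ℤ)) := by
        rw [exponent_cast]
        simp
      rw [if_pos hc, prod_eq_one (fun i _ => by rw [Nat.choose_self, Nat.cast_one]), mul_one]
    · exact Fintype.mem_piFinset.mpr fun i => mem_range.mpr (Nat.lt_succ_self _)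
    · intro s hs hsd
      exact if_neg fun hex => hsd (hcond d s hs hex).1
  · intro γ _ hγd
    exact sum_eq_zero fun s hs => if_neg fun hex => hγd (DFunLike.coe_injective (hcond γ s hs hex).2)
  · intro h
    have h0 : MvPolynomial.coeff d ψ = 0 := by simpa [MvPolynomial.mem_support_iff] using h
    simp [h0]

end LowDegreeVanishing

open LowDegreeVanishing in
/-- **Stub `stub_lowDegreeVanishing`** of line `registered` (skeleton v2) of the crux
`BinomialElusive.BinomialCandidate`: under (P1) (no relation of length `≤ 4`) and (P2) (a congruence
modulus `M'`), a polynomial `ψ` avoiding the variable `i₀`, without constant term, with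
`ψ(T) ≡ T_{i₀} (mod t^G)` for `T_i = t^{N a_i} + t^{N b_i}` and `G > 2 N a_i, 2 N b_i`, has all
coefficients of degree `≤ 2` equal to zero. -/
theorem stub_lowDegreeVanishing :
    ∀ (m : ℕ) (a b : Fin m → ℕ) (N : ℕ), 0 < N →
      (∀ u v : Fin m → ℤ, ∑ i, (|u i| + |v i|) ≤ 4 → ∑ i, (u i * (a i : ℤ) + v i * (b i : ℤ)) = 0 → (u, v) = 0) →
      (∃ M' : ℕ, (∀ i, a i % M' = 1 ∧ b i % M' = 1) ∧
        (∀ i j, 2 * a i < M' * a j ∧ 2 * a i < M' * b j ∧ 2 * b i < M' * a j ∧ 2 * b i < M' * b j)) →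
      ∀ (i₀ : Fin m) (ψ : MvPolynomial (Fin m) ℂ) (G : ℤ),
        (∀ d ∈ ψ.support, d i₀ = 0) → MvPolynomial.constantCoeff ψ = 0 →
        (∀ i, 2 * ((N * a i : ℕ) : ℤ) < G ∧ 2 * ((N * b i : ℕ) : ℤ) < G) →
        (∀ g < G, (MvPolynomial.aeval (fun i : Fin m => (HahnSeries.single ((N * a i : ℕ) : ℤ) (1 : ℂ) +
            HahnSeries.single ((N * b i : ℕ) : ℤ) (1 : ℂ) : LaurentSeries ℂ)) ψ).coeff g =
          (HahnSeries.single ((N * a i₀ : ℕ) : ℤ) (1 : ℂ) +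
            HahnSeries.single ((N * b i₀ : ℕ) : ℤ) (1 : ℂ) : LaurentSeries ℂ).coeff g) →
        ∀ d : Fin m →₀ ℕ, (d.sum fun _ e => e) ≤ 2 → MvPolynomial.coeff d ψ = 0 := by
  intro m a b N hN hP1 hP2 i₀ ψ G hsupp hcc hG hcong d hd
  obtain ⟨M', hmod, hlt⟩ := hP2
  by_cases hd0 : d = 0
  · subst hd0
    rw [MvPolynomial.constantCoeff_eq] at hcc
    exact hcc
  have hdeg : ∑ i, d i ≤ 2 := by rwa [Finsupp.sum_fintype _ _ (fun _ => rfl)] at hd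
  by_contra hne
  have hdi₀ : d i₀ = 0 := hsupp d (MvPolynomial.mem_support_iff.mpr hne)
  have h1 := hcong _ (special_lt hG hdeg i₀)
  rw [coeff_aeval_special a b N M' hN hP1 hmod hlt ψ d hdeg hd0, AffinePeeling.coeff_binomial hN] at h1
  obtain ⟨hEa, hEb⟩ := sum_ne_of_noShortRelation a b hP1 (⇑d) hdeg i₀ hdi₀
  rw [if_neg hEa, if_neg hEb, add_zero] at h1
  exact hne h1

end Summit.ValiantsHypothesis.ValiantsHypothesis.Theorems.BinomialCandidateStubs
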